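import Literature.Computability.AlgebraicComplexity.VSBRProductDepth
import HarnessLib

/-!
# Route `DepthWindow` — top bracket of the product-depth dial, part 1/5: definitions

Decomp-valiant workshop, lens 4 «depth-reduction / chasm axis», generation 48 (cell O32 «top-bracket
squeeze»).  Route-independent (imports no `Theses` file).  The five parts prove: every polynomial of total
degree `≤ d` with fan-in-two complexity `L` over `N` variables has, for every FIXED `K ≥ 1`, an unbounded
fan-in circuit of product-depth `≤ ⌈⌈log₂ d⌉/K⌉` with `poly_K(N, d, L)` wires (part 4,
`exists_computes_productDepth_le_clog_div`), hence on the dial of `Theorems/DepthWindowDial.lean` the top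
bracket `A_{⌈log₂ n⌉/K+1} ↔ VH` holds at EVERY positive fraction of `log₂ n` (part 5,
`perHardAtDepth_clog_div_succ_iff_vh`).

THIS PART holds all the definitions (parts 2–5 are definition-free):
* §1 the `K`-fold `×`-balanced expansion of an atom of a homogeneous normal form `H` — Tavenas' expansion
  (`HomCircuit.expandAtom`, tree file `GateQuotients.lean`: an atom `[ν]` / `[ν:μ]` of formal degree `D ≥ 2`
  is a sum of `≤ #ι²` products of `≤ 5` atoms of formal degree `≤ D/2`) made TOTAL (`exp1`), distributed
  over a term (`cart`, `expandTerm`) and iterated (`expandIter K`; term-count exponent `iterExp K = Σ_{i<K} 5^i`);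
* §2 the interface `Scheme H` of a one-level expansion (terms `E`, width `W`, fan-in `F`, degree base `B`);
* §3 the levelled circuit of a scheme (VSBR bookkeeping with the three parameters `W, F, B`): level `0` =
  one affine gate per atom (`levelZero`); level `j + 1` = `#atoms · W` product gates (`prodLayer`) and one
  value gate per atom (`sumLayer`); `gatesUpTo`, `circuit`;
* §4 the wire bound `iterEdgeBound K N d s` of the `K`-fold instance (`I = 4 s (d+1)²` bounds the nodes of
  the homogenisation of a length-`s` straight-line program).
Nothing here bears on `VP ≠ VNP`.

References: [ValiantSkyumBerkowitzRackoff1983]; [Burgisser2000TCS] Thm. 2.5; [Tavenas2015] §4 Def. 4, §5 Prop. 3;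
[AgrawalVinay2008]; [LimayeSrinivasanTavenas2025] §1 (product depth).
-/

-- layout Summits/ValiantsHypothesis/ValiantsHypothesis forces the duplicated namespace component
set_option linter.dupNamespace false

noncomputable section

open MvPolynomial Literature.Computability.AlgebraicComplexity
open Literature.Computability.AlgebraicComplexity.DepthReduction ArithCircuit
open Literature.Computability.AlgebraicComplexity.DepthReduction.HomCircuit (Atom termWidth)

namespace Summit.ValiantsHypothesis.ValiantsHypothesis.Theorems.DepthWindow

namespace TopBracket

universe u v w

variable {k : Type u} {σ : Type v} {ι : Type w} [CommSemiring k]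

/-! ## §1 The `K`-fold `×`-balanced expansion of an atom -/

section Expansion

variable (H : HomCircuit k σ ι) [DecidableEq ι] [Fintype ι]

/-- One TOTAL expansion step: the `×`-balanced expansion of an atom of formal degree `≥ 2`
(Tavenas 2015, Prop. 3), the atom itself otherwise. [cite: Tavenas2015, §5 Prop. 3] -/
def exp1 (a : Atom ι) : List (List (Atom ι)) :=
  if 2 ≤ H.adeg a then H.expandAtom a else [[a]]

/-- All concatenations `T₁ ++ ⋯ ++ Tₘ` with `Tᵢ` drawn from the `i`-th list of terms (distributing a
product of sums of products). [folklore] -/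
def cart : List (List (List (Atom ι))) → List (List (Atom ι))
  | [] => [[]]
  | L :: Ls => L.flatMap fun T => (cart Ls).map fun U => T ++ U

/-- One total step applied to every atom of a term, distributed. [folklore] -/
def expandTerm (T : List (Atom ι)) : List (List (Atom ι)) := cart (T.map (exp1 H))

/-- **The `K`-fold expansion** of an atom: `K` total steps, distributed (Agrawal–Vinay / Tavenas
regrouped `K` halvings at a time). [cite: Tavenas2015, §5 Prop. 3] [cite: AgrawalVinay2008] -/
def expandIter : ℕ → Atom ι → List (List (Atom ι))
  | 0, a => [[a]]
  | K + 1, a => (expandIter K a).flatMap (expandTerm H)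

/-- Exponent of the term count after `K` steps: `Σ_{i<K} 5^i`. [folklore] -/
def iterExp : ℕ → ℕ
  | 0 => 0
  | K + 1 => iterExp K + 5 ^ K

end Expansion

/-! ## §2 One-level expansion schemes (the interface of the level construction) -/

section SchemeDef

variable [DecidableEq ι]

/-- A one-level expansion scheme for the atoms of `H`: every atom of formal degree `≥ 2` is a sum of
`≤ W` formal products (terms) of `≤ F` atoms, each of formal degree `≤ 1` or `≤ (1/B)`·(the atom's);
`VSBRProductDepth.lean` is the scheme `(expandAtom, #ι², 5, 2)`, §1 gives `(expandIter K, (#ι²)^{iterExp K},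
5^K, 2^K)`. [cite: ValiantSkyumBerkowitzRackoff1983] [cite: Tavenas2015, §5 Prop. 3] -/
structure Scheme (H : HomCircuit k σ ι) where
  /-- the terms of an atom -/
  E : Atom ι → List (List (Atom ι))
  /-- maximal number of terms -/
  W : ℕ
  /-- maximal number of atoms of a term -/
  F : ℕ
  /-- degree base: atoms of a term have formal degree `≤ 1` or `B`·(their degree) `≤` the atom's -/
  B : ℕ
  B_pos : 0 < B
  length_le : ∀ a, (E a).length ≤ W
  tlength_le : ∀ a, ∀ T ∈ E a, T.length ≤ F
  sum_eq : ∀ a, 2 ≤ H.adeg a → ((E a).map H.tval).sum = H.aval a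
  deg_le : ∀ a, ∀ T ∈ E a, ∀ b ∈ T, H.adeg b ≤ 1 ∨ B * H.adeg b ≤ H.adeg a

end SchemeDef

/-! ## §3 The levelled circuit of a scheme -/

section LevelZero

variable (H : HomCircuit k σ ι) [DecidableEq ι] [Fintype ι] [Fintype σ] [DecidableEq σ]

/-- Level `0`: one affine gate per atom (correct for the atoms of formal degree `≤ 1`).
[cite: ValiantSkyumBerkowitzRackoff1983] -/
def levelZero : List (Gate k σ) :=
  (List.finRange (Fintype.card (Atom ι))).map fun m =>
    affineGate (H.aval ((Fintype.equivFin (Atom ι)).symm m))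

end LevelZero

namespace Scheme

variable {H : HomCircuit k σ ι} [DecidableEq ι] [Fintype ι] (S : Scheme H)

/-- Gates of one level `j ≥ 1`: `#atoms · W` product gates and `#atoms` value gates. [folklore] -/
def blockLen : ℕ := Fintype.card (Atom ι) * S.W + Fintype.card (Atom ι)

/-- Index of the first value gate of level `j`. [folklore] -/
def vbase (j : ℕ) : ℕ := j * S.blockLen

/-- Number of gates of the levels `0, …, j`. [folklore] -/
def plen (j : ℕ) : ℕ := S.vbase j + Fintype.card (Atom ι)

/-- Index of the value gate of the atom `a` at level `j`. [folklore] -/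
def vIdx (j : ℕ) (a : Atom ι) : ℕ := S.vbase j + (Fintype.equivFin (Atom ι) a).val

/-- The `r`-th product gate of the atom `a` at level `j + 1`: the product of the level-`j` value gates
of the atoms of the `r`-th term of `a` (an empty sum gate if there are fewer terms).
[cite: ValiantSkyumBerkowitzRackoff1983] -/
def prodGate (j : ℕ) (a : Atom ι) (r : Fin S.W) : Gate k σ :=
  if h : r.val < (S.E a).length then
    .prod (((S.E a)[r.val]).map fun b => Operand.gate (S.vIdx j b))
  else .sum []

/-- The product layer of level `j + 1`: gate `(a, r)` at position `finProdFinEquiv (a, r)`.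
[cite: ValiantSkyumBerkowitzRackoff1983] -/
def prodLayer (j : ℕ) : List (Gate k σ) :=
  (List.finRange (Fintype.card (Atom ι) * S.W)).map fun q =>
    S.prodGate j ((Fintype.equivFin (Atom ι)).symm (finProdFinEquiv.symm q).1) (finProdFinEquiv.symm q).2

/-- The value gate of the atom `a` at level `j + 1`: the sum of its product gates if its formal degree is
`≥ 2`, else a copy of its level-`j` value gate. [cite: ValiantSkyumBerkowitzRackoff1983] -/
def sumGate (j : ℕ) (a : Atom ι) : Gate k σ :=
  if 2 ≤ H.adeg a then
    .sum ((List.finRange S.W).map fun r =>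
      (1, Operand.gate (S.plen j + (finProdFinEquiv (Fintype.equivFin (Atom ι) a, r)).val)))
  else .sum [(1, Operand.gate (S.vIdx j a))]

/-- The value layer of level `j + 1`. [cite: ValiantSkyumBerkowitzRackoff1983] -/
def sumLayer (j : ℕ) : List (Gate k σ) :=
  (List.finRange (Fintype.card (Atom ι))).map fun m => S.sumGate j ((Fintype.equivFin (Atom ι)).symm m)

variable [Fintype σ] [DecidableEq σ]

/-- The gates of the levels `0, …, j`. [cite: ValiantSkyumBerkowitzRackoff1983] -/
def gatesUpTo : ℕ → List (Gate k σ)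
  | 0 => levelZero H
  | j + 1 => gatesUpTo j ++ S.prodLayer j ++ S.sumLayer j

/-- **The levelled circuit** of product-depth `Λ` summing the values of the atoms `ns`.
[cite: ValiantSkyumBerkowitzRackoff1983] [cite: Burgisser2000TCS, Thm. 2.5] -/
def circuit (Λ : ℕ) (ns : List (Atom ι)) : ArithCircuit k σ where
  gates := S.gatesUpTo Λ ++ [.sum (ns.map fun a => (1, Operand.gate (S.vIdx Λ a)))]
  output := .gate (S.plen Λ)

end Scheme

/-! ## §4 The wire bound of the `K`-fold instance -/

/-- The wire bound of the `K`-fold levelled circuit of a value of degree `≤ d` of a straight-line program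
of length `s` over `N` variables (`I = 4 s (d+1)²` bounds the nodes of the homogenisation): polynomial in
`N, d, s` for fixed `K`. [cite: ValiantSkyumBerkowitzRackoff1983] [cite: Tavenas2015, Prop. 2, Prop. 3] -/
def iterEdgeBound (K N d s : ℕ) : ℕ :=
  (4 * s * (d + 1) ^ 2 + (4 * s * (d + 1) ^ 2) * (4 * s * (d + 1) ^ 2)) * (N + 1) +
    d * ((4 * s * (d + 1) ^ 2 + (4 * s * (d + 1) ^ 2) * (4 * s * (d + 1) ^ 2)) *
          ((4 * s * (d + 1) ^ 2) * (4 * s * (d + 1) ^ 2)) ^ iterExp K * 5 ^ K +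
        (4 * s * (d + 1) ^ 2 + (4 * s * (d + 1) ^ 2) * (4 * s * (d + 1) ^ 2)) *
          (((4 * s * (d + 1) ^ 2) * (4 * s * (d + 1) ^ 2)) ^ iterExp K + 1)) +
    (d + 1)

end TopBracket

end Summit.ValiantsHypothesis.ValiantsHypothesis.Theorems.DepthWindow

end
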